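import Literature.MathematicalPhysics.QuantumFieldTheory.Balaban1983to89.B1Ineq225RegularTorus
import Literature.MathematicalPhysics.QuantumFieldTheory.Balaban1983to89.B1Ineq224BackgroundTorusWalk

/-!
# `Balaban1983to89.B1Ineq224RegularTorus` — T. Bałaban, *(Higgs)₂,₃ quantum fields in a finite volume. I. A lower bound*,
# Commun. Math. Phys. **85** (1982) 603–626 [Balaban1982Higgs1], Prop. 2.1 (2.24) — THE HÖLDER CLAUSE WITH ITS DECAY FACTOR ON `Ω = T_ε`
# **AT EVERY (2.23)-REGULAR VECTOR FIELD `A`** of the (Higgs)₂,₃ carrier = [Balaban1983RegularityDecay] Theorem (1.9) on the torus: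
# by the two regimes of p. 578 — the walk (2.13) for the Hölder probe when `|x − x′| ≦ L^K` (gen 10's `norm_holder_propagatorK_univ_le`,
# field-generic) and, beyond, the derivative member of `B1Ineq225RegularTorus` (our gloss «a simple consequence of (1.10)» of the printed
# sentence p. 578 quoted below)

statement-level skeleton of published theorems with citation tags; proofs where landed; nothing here is a claim about the Yang–Mills mass gap

PDF held: `paper:balaban1982-cmp85-higgs23-i` pp. 604–605, 610–611 [PDF 2–3, 8–9]; `paper:balaban1983-cmp89-regularity-decay` pp. 572–579.

CITATION HEADER (lean-in-tree rule).  Cell `lit-balaban` (HOME `run/shared/lean/pub/lit-balaban/`), Phase-2 proof seat **p35** gen 11 (unit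
`lit-balaban-p35`); SKELETON rows **B1.Prop2.1** ((2.24) HÖLDER clause WITH DECAY at EVERY (2.23)-regular `A`, `Ω = T_ε`: MODEL INSTANCE on the
(Higgs)₂,₃ carrier) and **B4.Thm@573** ((1.9) on the torus at a regular field, carrier instance).  USED BY NAME, never restated: this seat's
`B1Ineq225RegularTorus.{abs_acT_sub_le_of_reg, cube_inputs_reg, norm_covDeriv_propagatorK_reg_decay_of_cubes}` (gen 11), gen 10's
`B1Ineq224BackgroundTorusWalk.norm_holder_propagatorK_univ_le` (the walk for the Hölder probe, ANY `A`, modulo cube inputs) and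
`B1TorusCubeHolderInput.cube_input_holder` (Lemma 2.2 (2.16) Hölder member on the torus cubes, any field regular in the chart form),
`B1TorusChainTransport.{IsTChain, hol, norm_hol_apply}`, `B1Ineq225DecayBackgroundTorus.eight_rS_le`, `B1Ineq225BackgroundTorus.three_half_le_sites`.
WHAT IS PRINTED.  [B1] p. 610 [PDF 8], verbatim: *"For an arbitrary pair of points x, x′ ∈ T_η let us denote yb [sic] Γ_{x,x′} a shortest contour
connecting these points. Then for e(L^kε) sufficiently small and α < 1 there exist positive constants δ₀, c₀, R₀ independent of A, k, Ω and
depending on d, a, M only, c₀ on α also, such that for an arbitrary function f : Ω → R^N we have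
(1/|x − x′|^α)|U(A(Γ_{x,x′}))(D^η_{A,μ}G_k(Ω, A)f)(x′) − (D^η_{A,μ}G_k(Ω, A)f)(x)| ≦ c₀ exp(−δ₀ dist({x, x′}, supp f))‖f‖_∞ (2.24) for x, x′ ∈ Ω
and satisfying the condition dist({x, x′}, Ω^c) ≧ R₀."*; p. 611 [PDF 9], verbatim: *"so in the case Ω = T_η the condition dist({x, x′}, Ω^c) ≧ R₀
is meaningless and is omitted."*  [B4] p. 578 [PDF 8] L7–9, verbatim (materialised `paper:balaban1983-cmp89-regularity-decay/p0008.txt` L7–9,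
re-read by this seat; page image `1983-cmp89-regularity-decay-p008-x2.png` per the B1 fold owner's audit QUOTE-AUDIT-B1-p35): *«If |x′ − x| > 1,
then this inequality is a simple consequence of the corresponding inequality for the derivative only, hence we can assume |x′ − x| ≦ 1.»*
(«this inequality» = (1.9), «the corresponding inequality for the derivative» = (1.10); v1.0 of this header carried our paraphrase «… is a
simple consequence of (1.10), so it is enough to consider the case |x − x′| ≦ 1» marked as verbatim — re-keyed here, NOTE S-B1-r14g16-2.)  READING PROVED HERE (unit conversions as in `B1Ineq225RegularTorus`, not printed displays): hypothesis = (2.23) bond by bond,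
`(L^Kε|e|/e_K)|A_ν(x + εe_μ) − A_ν(x)| ≦ c·e_K^{β−1}/L^K`; conclusion = (2.24) for the ε-lattice propagator (2.20) (`D^ε = (L^kε)^{−1}D^η`,
`G^ε_K = (L^Kε)²G_K`, `|x − x′|` in `η`-units = `t/L^K`, `t` the lattice-step distance), the contour `Γ_{x,x′}` read as ANY nearest-neighbour chain
from `x` to `x′` with `|Γ| ≦ d·|x − x′|_∞` (as in gen 10 and in r01's typed `lhs19`).

WHAT THIS FILE PROVES (kernel-checked, zero `sorry`, theorems only; axioms standard).
* §1 `cube_input_holder_reg` — the Hölder cube input (2.16) on every cube at `Ã_j` for EVERY (2.23)-regular `A` with `e_K ≦ e₃(K₀)`.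
* §2 **`norm_holder_propagatorK_reg_decay_of_cubes`** — (2.24) WITH ITS DECAY FACTOR AT EVERY REGULAR `A`: for `d`, `L ≧ 2`, `a, m² > 0`, `N`,
  `(e,q)`, `ε₀`, `(c, β)`: a cube-size threshold `K₀min` (chosen BEFORE `α`, «M sufficiently large»), and for every `0 ≦ α < 1` constants
  `c₀(α) > 0`, per cube size a threshold `e₁(K₀) > 0` and a rate `δ₀(K₀) > 0`, such that for `K₀ ≧ K₀min`, on EVERY torus of the carrier with `K₀ ∣ M`, at every level `1 ≦ K ≦ K_P` with `3·L^KK₀ ≦ |T_ε|_μ`, `L^Kε ≦ ε₀`,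
  for EVERY vector field `A` and `0 < e_K ≦ e₁(K₀)` with (2.23), every `g` with `‖g‖_∞ ≦ M′` vanishing within lattice distance `D` of `x` and of
  `x′`, every `μ`, `x′ ≠ x` and nearest-neighbour chain `Γ` from `x` to `x′` with `|Γ| ≦ d|x − x′|`:
  `(|x − x′|/L^K)^{−α}·‖U(A(Γ))(D^ε_AG^ε_K(T_ε,A)g)(⟨x′,μ⟩) − (D^ε_AG^ε_K(T_ε,A)g)(⟨x,μ⟩)‖ ≦ c₀(L^Kε)e^{−δ₀(K₀)D/L^K}M′`;
  packaging `norm_holder_propagatorK_reg_decay` («`K₀ ∣ M`, `3K₀ ≦ 2M`»).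
HONEST SCOPE.  As `B1Ineq225RegularTorus`: `Ω = T_ε` only (p. 610 L1), `m² > 0` with the cap `m²(L^Kε)² ≦ m²ε₀²`, `L ≧ 2`, every torus of
the carrier; constants existential, functions of `(d, L, a, m²ε₀², N, (e,q), c, β)`, `α` (for `c₀`, `e₁`, `δ₀`) and `K₀`; gen 10's `A^{(K),ε}`
theorem is the instance `(c, β) = (1, ½)`.  Unit `lit-balaban-p35` gen 11 (literature-prover-lit-balaban-p35-g11-0); v1.1 (gen 15,
literature-prover-lit-balaban-p35-g15-0, DOC-ONLY, declarations byte-identical): the [B4] p. 578 sentence re-keyed to the printed words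
(B1 fold owner r14 g16, NOTE S-B1-r14g16-2 of `lit-balaban-r14/QUOTE-AUDIT-B1-p35.md`); the title line l.9 and the proof comment in §2 keep
«a simple consequence of (1.10)» as OUR GLOSS, not as a quotation.
-/

open scoped BigOperators

namespace Literature.MathematicalPhysics.QuantumFieldTheory.Balaban1983to89.B1Ineq224RegularTorus

open Literature.MathematicalPhysics.QuantumFieldTheory.Balaban1983to89.HiggsLattice (ChargeData sderiv covDeriv)
open Literature.MathematicalPhysics.QuantumFieldTheory.Balaban1983to89.HiggsCovariance (propagatorK covOpK)
open Literature.MathematicalPhysics.QuantumFieldTheory.Balaban1983to89.B1TorusCubeCover (half Lab Near cube hTor)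
open Literature.MathematicalPhysics.QuantumFieldTheory.Balaban1983to89.B1TorusCubeLocality26 (rS cubeVec)
open Literature.MathematicalPhysics.QuantumFieldTheory.Balaban1983to89.B1TorusCubeChart (dd dd_succ castD toT M2 predL_succ)
open Literature.MathematicalPhysics.QuantumFieldTheory.Balaban1983to89.B1TorusCubeBoxOp (acT)
open Literature.MathematicalPhysics.QuantumFieldTheory.Balaban1983to89.B4Lemma22ReduceZero (Box)
open Literature.MathematicalPhysics.QuantumFieldTheory.Balaban1983to89.B4Lower18Regular (e1)
open Literature.MathematicalPhysics.QuantumFieldTheory.Balaban1983to89.B4GaugeCovariance (pathEnd)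
open Literature.MathematicalPhysics.QuantumFieldTheory.Balaban1983to89.B4PartitionUnity22 (hprof D1 D2 D1_nonneg D2_nonneg contDiff_hprof
  hasCompactSupport_hprof)
open Literature.MathematicalPhysics.QuantumFieldTheory.Balaban1983to89.B1Ineq225BackgroundTorus (three_half_le_sites)
open Literature.MathematicalPhysics.QuantumFieldTheory.Balaban1983to89.B1Ineq225DecayBackgroundTorus (eight_rS_le)
open Literature.MathematicalPhysics.QuantumFieldTheory.Balaban1983to89.B1TorusChainTransport (IsTChain hol norm_hol_apply)
open Literature.MathematicalPhysics.QuantumFieldTheory.Balaban1983to89.B1TorusCubeHolderInput (cube_input_holder)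
open Literature.MathematicalPhysics.QuantumFieldTheory.Balaban1983to89.B1Ineq224BackgroundTorusWalk (norm_holder_propagatorK_univ_le)
open Literature.MathematicalPhysics.QuantumFieldTheory.Balaban1983to89.B1Ineq225RegularTorus (abs_acT_sub_le_of_reg cube_inputs_reg
  norm_covDeriv_propagatorK_reg_decay_of_cubes)

variable {P : HiggsLattice.Params} {N : ℕ}

/-! ## §1 The Hölder cube input at every (2.23)-regular field -/

section CubeInputs

/-- **THE HÖLDER CUBE INPUT (2.16) AT `Ã_j` FOR EVERY (2.23)-REGULAR FIELD**: a constant `C_H > 0` and per cube size `K₀ ≧ 8` a threshold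
`e₃(K₀) > 0` such that for EVERY `A` and `0 < e_K ≦ e₃(K₀)` with (2.23), on every cube `□_j`, with `u_j = G_K(□_j, Ã_j)(h_jψ)`:
`‖U(Ã_j(Γ))(D^ε_{Ã_j}u_j)(⟨x′,μ⟩) − (D^ε_{Ã_j}u_j)(⟨x,μ⟩)‖ ≦ C_H(|x − x′|/L^K)^α(L^Kε)‖ψ‖_∞` for `x, x+e_μ, x′, x′+e_μ ∈ □_j`, `x′ ≠ x` and every
nearest-neighbour chain `Γ ⊂ □_j` from `x` to `x′` with `|Γ| ≦ d|x − x′|` — gen 10's `cube_input_holder` with the chart-form (1.7) supplied by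
`abs_acT_sub_le_of_reg`. [cite: Balaban1982Higgs1, Prop. 2.1 (2.23) p.610] [cite: Balaban1983RegularityDecay, Lemma 2.2 (2.16) pp.577–578] -/
theorem cube_input_holder_reg (C : ChargeData N) (d0 ℓ0 : ℕ) (hℓ0 : 1 ≤ ℓ0) {a : ℝ} (ha : 0 < a) {msq : ℝ} (hmsq : 0 < msq)
    (m2plus : ℝ) (creg β : ℝ) (hcreg : 0 ≤ creg) (hβ : 0 < β) {α : ℝ} (hα0 : 0 ≤ α) (hα1 : α < 1) :
    ∃ CH : ℝ, 0 < CH ∧ ∃ e₃ : ℕ → ℝ, (∀ K₀, 0 < e₃ K₀) ∧ ∀ K₀ : ℕ, 8 ≤ K₀ →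
      ∀ (P : HiggsLattice.Params), dd P = d0 → P.L - 1 = ℓ0 → ∀ {K : ℕ}, 1 ≤ K → K ≤ P.K → K₀ ∣ P.M →
      (∀ μ, 3 * half P K K₀ ≤ P.sitesPerDir 0 μ) → msq * P.mesh K ^ 2 ≤ m2plus →
      ∀ (A : HiggsLattice.VecField P 0) {ec : ℝ}, 0 < ec → ec ≤ e₃ K₀ →
      (∀ (x : HiggsLattice.Site P 0) (μ ν : Fin P.d),
          P.mesh K * |C.e| / ec * |A ⟨x.shift μ, ν⟩ - A ⟨x, ν⟩| ≤ creg * ec ^ (β - 1) / (P.L : ℝ) ^ K) →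
      ∀ (j : Lab P K K₀) (ψ : HiggsLattice.ScalarField P 0 N) (μ : Fin P.d) (x x' : HiggsLattice.Site P 0)
        (l : List (HiggsLattice.Site P 0)),
        x ∈ cube K K₀ j → x.shift μ ∈ cube K K₀ j → x' ∈ cube K K₀ j → x'.shift μ ∈ cube K K₀ j → x' ≠ x →
        IsTChain x l → pathEnd x l = x' → (∀ y ∈ l, y ∈ cube K K₀ j) →
        (l.length : ℝ) ≤ (P.d : ℝ) * HiggsLattice.Site.tdist x x' →
        ‖hol C (cubeVec K K₀ j A) x l
              (covDeriv C (cubeVec K K₀ j A) (propagatorK C (cube K K₀ j) (cubeVec K K₀ j A) msq a K (hTor K K₀ j • ψ)) ⟨x', μ⟩)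
            - covDeriv C (cubeVec K K₀ j A) (propagatorK C (cube K K₀ j) (cubeVec K K₀ j A) msq a K (hTor K K₀ j • ψ)) ⟨x, μ⟩‖
          ≤ CH * ((HiggsLattice.Site.tdist x x' : ℝ) / (P.L : ℝ) ^ K) ^ α * P.mesh K * ‖ψ‖ := by
  obtain ⟨CH, hCH, hhi⟩ := cube_input_holder C d0 ℓ0 hℓ0 a a m2plus ha hα0 hα1
  have hhi' : ∀ K₀ : ℕ, ∃ e₁ : ℝ, 0 < e₁ ∧ _ := fun K₀ => hhi creg β hcreg hβ (max K₀ 8) (le_max_right _ _)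
  choose e₃ he₃ hhthr' using hhi'
  refine ⟨CH, hCH, e₃, he₃, fun K₀ hK₀8 => ?_⟩
  have hmax : max K₀ 8 = K₀ := max_eq_left hK₀8
  have hhthr := hhthr' K₀
  rw [hmax] at hhthr
  intro P hPd hPL K hK1 hK hK₀M hN3 hcap A ec hec hle hreg j ψ μ x x' l h1 h2 h3 h4 hne hch hend h5 hlen
  exact hhthr P hPd hPL K hK1 hK hK₀M hN3 a msq le_rfl le_rfl hmsq hcap j A ec hec hle (abs_acT_sub_le_of_reg C j A hec hreg)
    ψ μ x x' l h1 h2 h3 h4 hne hch hend h5 hlen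

end CubeInputs

/-! ## §2 (2.24) with its decay factor on `T_ε` at every (2.23)-regular field: the two regimes of p. 578 -/

section Main

/-- distinct torus sites are at (1.3)-distance at least one lattice unit. [cite: Balaban1982Higgs1, (1.3) p.604] -/
private theorem one_le_tdist_of_ne {k : ℕ} {x x' : HiggsLattice.Site P k} (h : x' ≠ x) : 1 ≤ HiggsLattice.Site.tdist x x' := by
  obtain ⟨μ, hμ⟩ : ∃ μ, x' μ ≠ x μ := by
    by_contra hc
    push Not at hc
    exact h (funext hc)
  unfold HiggsLattice.Site.tdist
  refine le_trans ?_ (Finset.le_sup (f := fun ν : Fin P.d => min (x ν - x' ν).val (x' ν - x ν).val) (Finset.mem_univ μ))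
  refine le_min ?_ ?_
  · exact Nat.one_le_iff_ne_zero.2 fun h0 => hμ (sub_eq_zero.1 ((ZMod.val_eq_zero _).1 h0)).symm
  · exact Nat.one_le_iff_ne_zero.2 fun h0 => hμ (sub_eq_zero.1 ((ZMod.val_eq_zero _).1 h0))

/-- the near-regime bookkeeping: `γ_T ≦ C_near·(t/n)^α·(L^Kε)` for `1 ≦ t ≦ n`, `|Γ| ≦ dt`, `K₀ ≧ 8`. [folklore] -/
private theorem gammaT_le {Pd K₀ : ℕ} (hK₀8 : 8 ≤ K₀) {D₁ D₂ CH Cδ Cγ t n m0 ℓ α : ℝ} (hD₁ : 0 ≤ D₁) (hD₂ : 0 ≤ D₂)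
    (hCδ : 0 ≤ Cδ) (hCγ : 0 ≤ Cγ) (hn : 0 < n) (hm0 : 0 < m0) (ht1 : 1 ≤ t) (htn : t ≤ n) (hℓ0 : 0 ≤ ℓ)
    (hℓ : ℓ ≤ (Pd : ℝ) * t) (hα1 : α < 1) :
    CH * (t / n) ^ α * (n * m0) + (Pd : ℝ) * (D₁ + D₂) / (K₀ : ℝ) * ((2 * ℓ + 2) / n) * (Cδ * (n * m0))
        + (D₁ ^ 2 + D₂) / (K₀ : ℝ) ^ 2 * ((Pd : ℝ) * ℓ / (n ^ 2 * m0)) * (Cγ * (n * m0) ^ 2)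
      ≤ (CH + (Pd : ℝ) * (D₁ + D₂) / 8 * (2 * (Pd : ℝ) + 2) * Cδ + (D₁ ^ 2 + D₂) / 64 * (Pd : ℝ) ^ 2 * Cγ) * (t / n) ^ α * (n * m0) := by
  have hK₀r : (8 : ℝ) ≤ K₀ := by exact_mod_cast hK₀8
  have ht0 : 0 < t := lt_of_lt_of_le one_pos ht1
  have hq0 : 0 < t / n := div_pos ht0 hn
  have hq1 : t / n ≤ 1 := (div_le_one hn).2 htn
  set w : ℝ := (t / n) ^ α with hw
  have hqw : t / n ≤ w := by
    have h := Real.rpow_le_rpow_of_exponent_ge hq0 hq1 hα1.le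
    rwa [Real.rpow_one] at h
  have hw0 : 0 ≤ w := Real.rpow_nonneg hq0.le α
  have hPd : (0 : ℝ) ≤ Pd := Nat.cast_nonneg _
  have h2a : (Pd : ℝ) * (D₁ + D₂) / (K₀ : ℝ) ≤ (Pd : ℝ) * (D₁ + D₂) / 8 :=
    div_le_div_of_nonneg_left (by positivity) (by norm_num) hK₀r
  have h2b : (2 * ℓ + 2) / n ≤ (2 * (Pd : ℝ) + 2) * w := by
    have h1 : 2 * ℓ + 2 ≤ (2 * (Pd : ℝ) + 2) * t := by nlinarith
    calc (2 * ℓ + 2) / n ≤ (2 * (Pd : ℝ) + 2) * t / n := div_le_div_of_nonneg_right h1 hn.le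
      _ = (2 * (Pd : ℝ) + 2) * (t / n) := by ring
      _ ≤ (2 * (Pd : ℝ) + 2) * w := mul_le_mul_of_nonneg_left hqw (by positivity)
  have h2 : (Pd : ℝ) * (D₁ + D₂) / (K₀ : ℝ) * ((2 * ℓ + 2) / n) * (Cδ * (n * m0))
      ≤ (Pd : ℝ) * (D₁ + D₂) / 8 * ((2 * (Pd : ℝ) + 2) * w) * (Cδ * (n * m0)) := by
    have h2c : 0 ≤ (2 * ℓ + 2) / n := by positivity
    gcongr
  have h3a : (D₁ ^ 2 + D₂) / (K₀ : ℝ) ^ 2 ≤ (D₁ ^ 2 + D₂) / 64 :=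
    div_le_div_of_nonneg_left (by positivity) (by norm_num) (by nlinarith)
  have h3e : (D₁ ^ 2 + D₂) / (K₀ : ℝ) ^ 2 * ((Pd : ℝ) * ℓ / (n ^ 2 * m0)) * (Cγ * (n * m0) ^ 2)
      = (D₁ ^ 2 + D₂) / (K₀ : ℝ) ^ 2 * ((Pd : ℝ) * ℓ) * (Cγ * m0) := by
    field_simp
  have h3b : (Pd : ℝ) * ℓ ≤ (Pd : ℝ) ^ 2 * w * n := by
    calc (Pd : ℝ) * ℓ ≤ (Pd : ℝ) * ((Pd : ℝ) * t) := mul_le_mul_of_nonneg_left hℓ hPd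
      _ = (Pd : ℝ) ^ 2 * (t / n) * n := by field_simp
      _ ≤ (Pd : ℝ) ^ 2 * w * n := by gcongr
  have h3 : (D₁ ^ 2 + D₂) / (K₀ : ℝ) ^ 2 * ((Pd : ℝ) * ℓ / (n ^ 2 * m0)) * (Cγ * (n * m0) ^ 2)
      ≤ (D₁ ^ 2 + D₂) / 64 * ((Pd : ℝ) ^ 2 * w * n) * (Cγ * m0) := by
    rw [h3e]
    have : 0 ≤ (Pd : ℝ) * ℓ := by positivity
    gcongr
  calc CH * (t / n) ^ α * (n * m0) + (Pd : ℝ) * (D₁ + D₂) / (K₀ : ℝ) * ((2 * ℓ + 2) / n) * (Cδ * (n * m0))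
        + (D₁ ^ 2 + D₂) / (K₀ : ℝ) ^ 2 * ((Pd : ℝ) * ℓ / (n ^ 2 * m0)) * (Cγ * (n * m0) ^ 2)
      ≤ CH * w * (n * m0) + (Pd : ℝ) * (D₁ + D₂) / 8 * ((2 * (Pd : ℝ) + 2) * w) * (Cδ * (n * m0))
        + (D₁ ^ 2 + D₂) / 64 * ((Pd : ℝ) ^ 2 * w * n) * (Cγ * m0) := by rw [hw]; linarith
    _ = (CH + (Pd : ℝ) * (D₁ + D₂) / 8 * (2 * (Pd : ℝ) + 2) * Cδ + (D₁ ^ 2 + D₂) / 64 * (Pd : ℝ) ^ 2 * Cγ) * w * (n * m0) := by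
        ring

set_option maxHeartbeats 800000 in
/-- **PROP. 2.1 (2.24), HÖLDER CLAUSE WITH ITS DECAY FACTOR, ON `Ω = T_ε`, AT EVERY (2.23)-REGULAR VECTOR FIELD `A` OF THE (Higgs)₂,₃ CARRIER —
B4's THEOREM (1.9) ON THE TORUS.**  For `d`, `L ≧ 2`, `a > 0`, `m² > 0`, `N`, `(e, q)`, a mesh cap `ε₀` and a regularity pair `c ≧ 0`, `β > 0`: a cube-size threshold `K₀min` chosen BEFORE `α` («with M
sufficiently large … c₀ on α also»), and for every `0 ≦ α < 1` constants `c₀ > 0`, per cube size `K₀` a threshold `e₁(K₀) > 0` and a rate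
`δ₀(K₀) > 0` such that for `K₀ ≧ K₀min`, on
EVERY torus of the carrier with `K₀ ∣ M`, at every level `1 ≦ K ≦ K_P` with `3·L^KK₀ ≦ |T_ε|_μ`, `L^Kε ≦ ε₀`, for EVERY vector field `A` and
`0 < e_K ≦ e₁(K₀)` with (2.23) in the form `(L^Kε|e|/e_K)|A_ν(x + εe_μ) − A_ν(x)| ≦ c·e_K^{β−1}/L^K`, every `g` with `‖g‖_∞ ≦ M′` vanishing at the
sites within lattice distance `< D` of `x` and of `x′` (`D ≧ 0`), every direction `μ`, sites `x′ ≠ x` and nearest-neighbour chain `Γ` from `x`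
to `x′` with `|Γ| ≦ d|x − x′|`:
`(|x − x′|/L^K)^{−α}·‖U(A(Γ))(D^ε_AG^ε_K(T_ε, A)g)(⟨x′,μ⟩) − (D^ε_AG^ε_K(T_ε, A)g)(⟨x,μ⟩)‖ ≦ c₀(L^Kε)·exp(−δ₀(K₀)·D/L^K)·M′`.  Proof: `|x − x′| ≦ L^K`
by the walk `norm_holder_propagatorK_univ_le` with `cube_inputs_reg` + `cube_input_holder_reg` (`δ = log 2/(2(rS + dL^K + 2))`); `|x − x′| > L^K`
from `norm_covDeriv_propagatorK_reg_decay_of_cubes` at both bonds. [cite: Balaban1982Higgs1, Prop. 2.1 (2.23)–(2.24) p.610]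
[cite: Balaban1983RegularityDecay, Theorem (1.9) p.573; p.578; (2.22) p.579] -/
theorem norm_holder_propagatorK_reg_decay_of_cubes (d L : ℕ) (hL : 2 ≤ L) {a : ℝ} (ha : 0 < a) {msq : ℝ} (hmsq : 0 < msq) (N : ℕ)
    (C : ChargeData N) (ε₀ : ℝ) (creg β : ℝ) (hcreg : 0 ≤ creg) (hβ : 0 < β) :
    ∃ K₀min : ℕ, ∀ {α : ℝ}, 0 ≤ α → α < 1 →
      ∃ c₀ : ℝ, 0 < c₀ ∧ ∃ e₁ δA : ℕ → ℝ, (∀ K₀, 0 < e₁ K₀ ∧ 0 < δA K₀) ∧ ∀ K₀ : ℕ, K₀min ≤ K₀ →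
      ∀ (P : HiggsLattice.Params), P.d = d → P.L = L → K₀ ∣ P.M →
      ∀ {K : ℕ}, 1 ≤ K → K ≤ P.K → (∀ μ, 3 * half P K K₀ ≤ P.sitesPerDir 0 μ) → P.mesh K ≤ ε₀ →
      ∀ (A : HiggsLattice.VecField P 0) {ec : ℝ}, 0 < ec → ec ≤ e₁ K₀ →
      (∀ (x : HiggsLattice.Site P 0) (μ ν : Fin P.d),
          P.mesh K * |C.e| / ec * |A ⟨x.shift μ, ν⟩ - A ⟨x, ν⟩| ≤ creg * ec ^ (β - 1) / (P.L : ℝ) ^ K) →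
        ∀ (g : HiggsLattice.ScalarField P 0 N) (M D : ℝ), (∀ x, ‖g x‖ ≤ M) → 0 ≤ D →
          ∀ (μ : Fin P.d) (x x' : HiggsLattice.Site P 0), x' ≠ x → ∀ l : List (HiggsLattice.Site P 0), IsTChain x l → pathEnd x l = x' →
            (l.length : ℝ) ≤ (P.d : ℝ) * HiggsLattice.Site.tdist x x' →
            (∀ z, g z ≠ 0 → D ≤ (HiggsLattice.Site.tdist x z : ℝ)) → (∀ z, g z ≠ 0 → D ≤ (HiggsLattice.Site.tdist x' z : ℝ)) →
              (((HiggsLattice.Site.tdist x x' : ℝ) / (P.L : ℝ) ^ K)⁻¹) ^ α *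
                  ‖hol C A x l (covDeriv C A (propagatorK C Finset.univ A msq a K g) ⟨x', μ⟩)
                    - covDeriv C A (propagatorK C Finset.univ A msq a K g) ⟨x, μ⟩‖
                ≤ c₀ * P.mesh K * Real.exp (-(δA K₀ * (D / (P.L : ℝ) ^ K))) * M := by
  have hℓ0 : 1 ≤ L - 1 := by omega
  obtain ⟨Cγ, Cδ, CT, Cβ, hCγ, hCδ, hCT, hCβ, e₁, he₁, hcube⟩ :=
    cube_inputs_reg C (d - 1) (L - 1) hℓ0 ha hmsq (msq * ε₀ ^ 2) creg β hcreg hβ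
  obtain ⟨c₉, hc₉, K₉, e₉, δ₉, hcδ₉, hfar⟩ := norm_covDeriv_propagatorK_reg_decay_of_cubes d L hL ha hmsq N C ε₀ creg β hcreg hβ
  -- the cube size is fixed BEFORE `α` («M sufficiently large … c₀ on α also»)
  refine ⟨max (max K₉ 8) (max (⌈(2 : ℝ) ^ (d + 2) * Cβ⌉₊) (8 * d + 24)), fun {α} hα0 hα1 => ?_⟩
  obtain ⟨CH, hCH, e₃, he₃, hhol⟩ := cube_input_holder_reg C (d - 1) (L - 1) hℓ0 ha hmsq (msq * ε₀ ^ 2) creg β hcreg hβ hα0 hα1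
  have hlog2 : 0 < Real.log 2 := Real.log_pos (by norm_num)
  have hD1 := D1_nonneg contDiff_hprof hasCompactSupport_hprof
  have hD2 := D2_nonneg contDiff_hprof hasCompactSupport_hprof
  set Cnear : ℝ := CH + (d : ℝ) * (D1 hprof + D2 hprof) / 8 * (2 * (d : ℝ) + 2) * Cδ + (D1 hprof ^ 2 + D2 hprof) / 64 * (d : ℝ) ^ 2 * Cγ
    with hCnear
  have hCnear0 : 0 < Cnear := by positivity
  refine ⟨4 * 2 ^ d * Cnear + 2 * c₉, by positivity,
    fun K₀ => min (min (e₁ K₀) (e₃ K₀)) (e₉ K₀), fun K₀ => min (Real.log 2 * 4 / (5 * K₀ + 8 * d + 24)) (δ₉ K₀),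
    fun K₀ => ⟨lt_min (lt_min (he₁ K₀) (he₃ K₀)) (hcδ₉ K₀).1,
      lt_min (div_pos (mul_pos hlog2 (by norm_num)) (by positivity)) (hcδ₉ K₀).2⟩,
    fun K₀ hK₀ => ?_⟩
  have hK₀9 : K₉ ≤ K₀ := le_trans (le_trans (le_max_left _ _) (le_max_left _ _)) hK₀
  have hK₀8 : 8 ≤ K₀ := le_trans (le_trans (le_max_right _ _) (le_max_left _ _)) hK₀
  have hK₀C : (2 : ℝ) ^ (d + 2) * Cβ ≤ K₀ :=
    (Nat.le_ceil _).trans (by exact_mod_cast le_trans (le_trans (le_max_left _ _) (le_max_right _ _)) hK₀)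
  have hK₀d : 8 * d + 24 ≤ K₀ := le_trans (le_trans (le_max_right _ _) (le_max_right _ _)) hK₀
  have h22 : (2 : ℝ) ^ (d + 2) = 2 ^ d * 4 := by rw [pow_add]; norm_num
  rw [h22] at hK₀C
  intro P hPd hPL hK₀M K hK1 hK hN3 hε A ec hec hle hreg g M D hg hD0 μ x x' hne l hch hend hlen hDx hDx'
  have hle₁ : ec ≤ e₁ K₀ := hle.trans ((min_le_left _ _).trans (min_le_left _ _))
  have hle₃ : ec ≤ e₃ K₀ := hle.trans ((min_le_left _ _).trans (min_le_right _ _))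
  have hle₉ : ec ≤ e₉ K₀ := hle.trans (min_le_right _ _)
  have hdd : dd P = d - 1 := by rw [← hPd]; rfl
  have hPL1 : P.L - 1 = L - 1 := by rw [hPL]
  have hmesh : 0 < P.mesh K := P.mesh_pos K
  have hcap : msq * P.mesh K ^ 2 ≤ msq * ε₀ ^ 2 :=
    mul_le_mul_of_nonneg_left (pow_le_pow_left₀ hmesh.le hε 2) hmsq.le
  have hcj := fun j => hcube K₀ hK₀8 P hdd hPL1 hK1 hK hK₀M hN3 hcap A hec hle₁ hreg j
  have hhj := hhol K₀ hK₀8 P hdd hPL1 hK1 hK hK₀M hN3 hcap A hec hle₃ hreg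
  have hfar' := fun (b : HiggsLattice.PBond P 0) (hb : ∀ z, g z ≠ 0 → D ≤ (HiggsLattice.Site.tdist b.src z : ℝ)) =>
    hfar K₀ hK₀9 P hPd hPL hK₀M hK1 hK hN3 hε A hec hle₉ hreg g M D hg hD0 b hb
  subst hPd
  have hL1 : (1 : ℝ) < P.L := by rw [hPL]; exact_mod_cast (show 1 < L by omega)
  have hmesh0 : 0 < P.mesh 0 := P.mesh_pos 0
  have hakP : 0 ≤ B1.aSeq a P.L K := (B1.aSeq_pos ha hL1 hK1).le
  have hM0 : 0 ≤ M := (norm_nonneg _).trans (hg x)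
  have hK₀pos : (0 : ℝ) < K₀ := by exact_mod_cast (show 0 < K₀ by omega)
  have hn0 : (0 : ℝ) < (P.L : ℝ) ^ K := by positivity
  set t : ℝ := (HiggsLattice.Site.tdist x x' : ℝ) with ht_def
  have ht1 : 1 ≤ t := by rw [ht_def]; exact_mod_cast one_le_tdist_of_ne hne
  have ht0 : 0 < t := lt_of_lt_of_le one_pos ht1
  have hq0 : 0 < t / (P.L : ℝ) ^ K := div_pos ht0 hn0
  have hEA : ∀ {δ' : ℝ}, min (Real.log 2 * 4 / (5 * K₀ + 8 * P.d + 24)) (δ₉ K₀) ≤ δ' →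
      Real.exp (-(δ' * (D / (P.L : ℝ) ^ K))) ≤ Real.exp (-(min (Real.log 2 * 4 / (5 * K₀ + 8 * P.d + 24)) (δ₉ K₀) * (D / (P.L : ℝ) ^ K))) :=
    fun h => Real.exp_le_exp.2 (neg_le_neg (mul_le_mul_of_nonneg_right h (by positivity)))
  set Q : ℝ := ‖hol C A x l (covDeriv C A (propagatorK C Finset.univ A msq a K g) ⟨x', μ⟩)
    - covDeriv C A (propagatorK C Finset.univ A msq a K g) ⟨x, μ⟩‖ with hQ_def
  have hQ0 : 0 ≤ Q := norm_nonneg _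
  by_cases hnt : HiggsLattice.Site.tdist x x' ≤ P.L ^ K
  · -- the regime `|x − x′| ≦ L^K`: the walk (2.13) for the Hölder probe
    have htn : t ≤ (P.L : ℝ) ^ K := by rw [ht_def]; exact_mod_cast hnt
    have hroom : 4 * (rS P K K₀ + P.d * P.L ^ K + 2) ≤ 3 * half P K K₀ := by
      have h8 := eight_rS_le (P := P) (K := K) (K₀ := K₀)
      have hn1 : 1 ≤ P.L ^ K := Nat.one_le_pow K P.L P.hL
      have hh : P.L ^ K * (8 * P.d + 24) ≤ P.L ^ K * K₀ := Nat.mul_le_mul_left _ hK₀d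
      unfold half at h8 ⊢
      have e1 : P.L ^ K * (8 * P.d + 24) = 8 * (P.d * P.L ^ K) + 24 * P.L ^ K := by ring
      rw [e1] at hh
      generalize P.L ^ K * K₀ = h at h8 hh ⊢
      generalize P.d * P.L ^ K = nd at hh ⊢
      omega
    set rH : ℕ := rS P K K₀ + P.d * P.L ^ K + 2 with hrH
    have hrH0 : (0 : ℝ) < rH := by positivity
    set δ : ℝ := Real.log 2 / (2 * (rH : ℝ)) with hδ_def
    have hδ0 : 0 ≤ δ := by positivity
    have hexp : Real.exp (δ * (2 * (rH : ℝ))) = 2 := by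
      rw [hδ_def, div_mul_cancel₀ _ (by positivity), Real.exp_log two_pos]
    have hsmall : (2 : ℝ) ^ P.d * (Cβ / K₀) * Real.exp (δ * (2 * (rH : ℝ))) ≤ 1 / 2 := by
      rw [hexp]
      have e : (2 : ℝ) ^ P.d * (Cβ / K₀) * 2 = (2 ^ P.d * 2 * Cβ) / K₀ := by ring
      rw [e, div_le_iff₀ hK₀pos]
      linarith
    have hmain := norm_holder_propagatorK_univ_le C hK hK₀M hK₀8 hN3 hroom hmsq a hakP A
      (γ0 := Cγ * P.mesh K ^ 2) (γD := Cδ * P.mesh K) (γH := CH * (t / (P.L : ℝ) ^ K) ^ α * P.mesh K) (β := Cβ / K₀)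
      (by positivity) (by positivity) (by positivity) (by positivity) hch hend hlen hnt
      (fun j ψ => (hcj j).1 ψ) (fun j ψ y ν hy hs => (hcj j).2.1 ψ y ν hy hs)
      (fun j ψ h1 h2 h3 h4 h5 => hhj j ψ μ x x' l h1 h2 h3 h4 hne hch hend h5 hlen)
      (fun j ψ => (hcj j).2.2.2 ψ) hδ0 hsmall g hg hD0 hDx
    rw [hexp] at hmain
    have hdd1 : ((dd P : ℝ) + 1) = (P.d : ℝ) := by
      rw [← dd_succ P]; push_cast; ring
    have hnR : ((((P.L - 1 + 1) ^ K : ℕ)) : ℝ) = (P.L : ℝ) ^ K := by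
      rw [predL_succ, Nat.cast_pow]
    have hmeshK : P.mesh K = (P.L : ℝ) ^ K * P.mesh 0 := by
      unfold HiggsLattice.Params.mesh; ring
    have hγ : CH * (t / (P.L : ℝ) ^ K) ^ α * P.mesh K
          + ((dd P : ℝ) + 1) * (D1 hprof + D2 hprof) / K₀ * ((2 * l.length + 2) / (((P.L - 1 + 1) ^ K : ℕ) : ℝ)) * (Cδ * P.mesh K)
          + (D1 hprof ^ 2 + D2 hprof) / (K₀ : ℝ) ^ 2 * ((P.d : ℝ) * l.length / ((((P.L - 1 + 1) ^ K : ℕ) : ℝ) ^ 2 * P.mesh 0))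
            * (Cγ * P.mesh K ^ 2)
        ≤ Cnear * (t / (P.L : ℝ) ^ K) ^ α * P.mesh K := by
      rw [hdd1, hnR, hmeshK, hCnear]
      exact gammaT_le hK₀8 hD1 hD2 hCδ.le hCγ.le hn0 hmesh0 ht1 htn (Nat.cast_nonneg _) hlen hα1
    have h8 : 8 * (rH : ℝ) ≤ (5 * (K₀ : ℝ) + 8 * P.d + 24) * (P.L : ℝ) ^ K := by
      have h := eight_rS_le (P := P) (K := K) (K₀ := K₀)
      have h' : ((8 * rS P K K₀ : ℕ) : ℝ) ≤ ((5 * half P K K₀ + 8 * P.L ^ K : ℕ) : ℝ) := by exact_mod_cast h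
      have hn1 : (1 : ℝ) ≤ (P.L : ℝ) ^ K := one_le_pow₀ hL1.le
      unfold half at h'
      push_cast at h' ⊢
      rw [hrH]; push_cast
      nlinarith
    have hcmp : Real.log 2 * 4 / (5 * (K₀ : ℝ) + 8 * P.d + 24) * (D / (P.L : ℝ) ^ K) ≤ δ * D := by
      rw [hδ_def, div_mul_div_comm, div_mul_eq_mul_div, div_le_div_iff₀ (by positivity) (by positivity)]
      have hlogD : 0 ≤ Real.log 2 * D := mul_nonneg hlog2.le hD0
      calc Real.log 2 * 4 * D * (2 * (rH : ℝ)) = Real.log 2 * D * (8 * (rH : ℝ)) := by ring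
        _ ≤ Real.log 2 * D * ((5 * (K₀ : ℝ) + 8 * P.d + 24) * (P.L : ℝ) ^ K) := mul_le_mul_of_nonneg_left h8 hlogD
    have hexpD : Real.exp (-(δ * D)) ≤ Real.exp (-(Real.log 2 * 4 / (5 * (K₀ : ℝ) + 8 * P.d + 24) * (D / (P.L : ℝ) ^ K))) :=
      Real.exp_le_exp.2 (by linarith)
    have hE0 := Real.exp_nonneg (-(min (Real.log 2 * 4 / (5 * K₀ + 8 * P.d + 24)) (δ₉ K₀) * (D / (P.L : ℝ) ^ K)))
    have hw : ((t / (P.L : ℝ) ^ K)⁻¹) ^ α * (t / (P.L : ℝ) ^ K) ^ α = 1 := by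
      rw [Real.inv_rpow hq0.le, inv_mul_cancel₀ (Real.rpow_pos_of_pos hq0 α).ne']
    have hQ : Q ≤ 4 * 2 ^ P.d * (Cnear * (t / (P.L : ℝ) ^ K) ^ α * P.mesh K)
        * Real.exp (-(min (Real.log 2 * 4 / (5 * K₀ + 8 * P.d + 24)) (δ₉ K₀) * (D / (P.L : ℝ) ^ K))) * M := by
      refine hmain.trans ?_
      have hE1 := (hexpD.trans (hEA (min_le_left _ _)))
      calc 2 * 2 ^ P.d * ((CH * (t / (P.L : ℝ) ^ K) ^ α * P.mesh K
              + ((dd P : ℝ) + 1) * (D1 hprof + D2 hprof) / K₀ * ((2 * l.length + 2) / (((P.L - 1 + 1) ^ K : ℕ) : ℝ)) * (Cδ * P.mesh K)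
              + (D1 hprof ^ 2 + D2 hprof) / (K₀ : ℝ) ^ 2 * ((P.d : ℝ) * l.length / ((((P.L - 1 + 1) ^ K : ℕ) : ℝ) ^ 2 * P.mesh 0))
                * (Cγ * P.mesh K ^ 2)) * 2) * Real.exp (-(δ * D)) * M
          ≤ 2 * 2 ^ P.d * (Cnear * (t / (P.L : ℝ) ^ K) ^ α * P.mesh K * 2)
              * Real.exp (-(min (Real.log 2 * 4 / (5 * K₀ + 8 * P.d + 24)) (δ₉ K₀) * (D / (P.L : ℝ) ^ K))) * M := by
            gcongr
        _ = _ := by ring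
    calc ((t / (P.L : ℝ) ^ K)⁻¹) ^ α * Q
        ≤ ((t / (P.L : ℝ) ^ K)⁻¹) ^ α * (4 * 2 ^ P.d * (Cnear * (t / (P.L : ℝ) ^ K) ^ α * P.mesh K)
            * Real.exp (-(min (Real.log 2 * 4 / (5 * K₀ + 8 * P.d + 24)) (δ₉ K₀) * (D / (P.L : ℝ) ^ K))) * M) :=
          mul_le_mul_of_nonneg_left hQ (Real.rpow_nonneg (inv_nonneg.2 hq0.le) α)
      _ = (((t / (P.L : ℝ) ^ K)⁻¹) ^ α * (t / (P.L : ℝ) ^ K) ^ α) * (4 * 2 ^ P.d * Cnear * P.mesh K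
            * Real.exp (-(min (Real.log 2 * 4 / (5 * K₀ + 8 * P.d + 24)) (δ₉ K₀) * (D / (P.L : ℝ) ^ K))) * M) := by ring
      _ = 4 * 2 ^ P.d * Cnear * P.mesh K
            * Real.exp (-(min (Real.log 2 * 4 / (5 * K₀ + 8 * P.d + 24)) (δ₉ K₀) * (D / (P.L : ℝ) ^ K))) * M := by rw [hw, one_mul]
      _ ≤ (4 * 2 ^ P.d * Cnear + 2 * c₉) * P.mesh K
            * Real.exp (-(min (Real.log 2 * 4 / (5 * K₀ + 8 * P.d + 24)) (δ₉ K₀) * (D / (P.L : ℝ) ^ K))) * M := by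
          gcongr; linarith
  · -- the regime `|x − x′| > L^K` (p. 578 «a simple consequence of the corresponding inequality for the derivative only»):
    -- the derivative member at both bonds
    have htn : (P.L : ℝ) ^ K < t := by
      rw [ht_def]; exact_mod_cast (not_le.1 hnt)
    have hw1 : ((t / (P.L : ℝ) ^ K)⁻¹) ^ α ≤ 1 :=
      Real.rpow_le_one (inv_nonneg.2 hq0.le) (inv_le_one_of_one_le₀ ((one_le_div hn0).2 htn.le)) hα0
    have h1 := hfar' ⟨x', μ⟩ hDx'
    have h2 := hfar' ⟨x, μ⟩ hDx
    have hE1 := hEA (min_le_right _ _)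
    have hQ : Q ≤ 2 * c₉ * P.mesh K * Real.exp (-(min (Real.log 2 * 4 / (5 * K₀ + 8 * P.d + 24)) (δ₉ K₀) * (D / (P.L : ℝ) ^ K))) * M := by
      refine (norm_sub_le _ _).trans ?_
      rw [norm_hol_apply]
      calc ‖covDeriv C A (propagatorK C Finset.univ A msq a K g) ⟨x', μ⟩‖
            + ‖covDeriv C A (propagatorK C Finset.univ A msq a K g) ⟨x, μ⟩‖
          ≤ c₉ * P.mesh K * Real.exp (-(δ₉ K₀ * (D / (P.L : ℝ) ^ K))) * M
            + c₉ * P.mesh K * Real.exp (-(δ₉ K₀ * (D / (P.L : ℝ) ^ K))) * M := add_le_add h1 h2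
        _ = 2 * c₉ * P.mesh K * Real.exp (-(δ₉ K₀ * (D / (P.L : ℝ) ^ K))) * M := by ring
        _ ≤ 2 * c₉ * P.mesh K * Real.exp (-(min (Real.log 2 * 4 / (5 * K₀ + 8 * P.d + 24)) (δ₉ K₀) * (D / (P.L : ℝ) ^ K))) * M := by
            gcongr
    have hE0 := Real.exp_nonneg (-(min (Real.log 2 * 4 / (5 * K₀ + 8 * P.d + 24)) (δ₉ K₀) * (D / (P.L : ℝ) ^ K)))
    calc ((t / (P.L : ℝ) ^ K)⁻¹) ^ α * Q ≤ 1 * Q := mul_le_mul_of_nonneg_right hw1 hQ0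
      _ ≤ 2 * c₉ * P.mesh K * Real.exp (-(min (Real.log 2 * 4 / (5 * K₀ + 8 * P.d + 24)) (δ₉ K₀) * (D / (P.L : ℝ) ^ K))) * M := by
          rw [one_mul]; exact hQ
      _ ≤ (4 * 2 ^ P.d * Cnear + 2 * c₉) * P.mesh K
            * Real.exp (-(min (Real.log 2 * 4 / (5 * K₀ + 8 * P.d + 24)) (δ₉ K₀) * (D / (P.L : ℝ) ^ K))) * M := by
          gcongr; nlinarith [pow_pos (two_pos : (0:ℝ) < 2) P.d]

/-- **THE SAME, WITH THE CUBE CONDITION AS «`K₀ ∣ M`, `3K₀ ≦ 2M`»** (then `3·L^KK₀ ≦ |T_ε|_μ` at every level `K ≦ K_P`).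
[cite: Balaban1982Higgs1, Prop. 2.1 (2.23)–(2.24) p.610] [cite: Balaban1983RegularityDecay, Theorem (1.9) p.573] -/
theorem norm_holder_propagatorK_reg_decay (d L : ℕ) (hL : 2 ≤ L) {a : ℝ} (ha : 0 < a) {msq : ℝ} (hmsq : 0 < msq) (N : ℕ)
    (C : ChargeData N) (ε₀ : ℝ) (creg β : ℝ) (hcreg : 0 ≤ creg) (hβ : 0 < β) :
    ∃ K₀min : ℕ, ∀ {α : ℝ}, 0 ≤ α → α < 1 →
      ∃ c₀ : ℝ, 0 < c₀ ∧ ∃ e₁ δA : ℕ → ℝ, (∀ K₀, 0 < e₁ K₀ ∧ 0 < δA K₀) ∧ ∀ K₀ : ℕ, K₀min ≤ K₀ →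
      ∀ (P : HiggsLattice.Params), P.d = d → P.L = L → K₀ ∣ P.M → 3 * K₀ ≤ 2 * P.M →
      ∀ {K : ℕ}, 1 ≤ K → K ≤ P.K → P.mesh K ≤ ε₀ →
      ∀ (A : HiggsLattice.VecField P 0) {ec : ℝ}, 0 < ec → ec ≤ e₁ K₀ →
      (∀ (x : HiggsLattice.Site P 0) (μ ν : Fin P.d),
          P.mesh K * |C.e| / ec * |A ⟨x.shift μ, ν⟩ - A ⟨x, ν⟩| ≤ creg * ec ^ (β - 1) / (P.L : ℝ) ^ K) →
        ∀ (g : HiggsLattice.ScalarField P 0 N) (M D : ℝ), (∀ x, ‖g x‖ ≤ M) → 0 ≤ D →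
          ∀ (μ : Fin P.d) (x x' : HiggsLattice.Site P 0), x' ≠ x → ∀ l : List (HiggsLattice.Site P 0), IsTChain x l → pathEnd x l = x' →
            (l.length : ℝ) ≤ (P.d : ℝ) * HiggsLattice.Site.tdist x x' →
            (∀ z, g z ≠ 0 → D ≤ (HiggsLattice.Site.tdist x z : ℝ)) → (∀ z, g z ≠ 0 → D ≤ (HiggsLattice.Site.tdist x' z : ℝ)) →
              (((HiggsLattice.Site.tdist x x' : ℝ) / (P.L : ℝ) ^ K)⁻¹) ^ α *
                  ‖hol C A x l (covDeriv C A (propagatorK C Finset.univ A msq a K g) ⟨x', μ⟩)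
                    - covDeriv C A (propagatorK C Finset.univ A msq a K g) ⟨x, μ⟩‖
                ≤ c₀ * P.mesh K * Real.exp (-(δA K₀ * (D / (P.L : ℝ) ^ K))) * M := by
  obtain ⟨K₀min, h⟩ := norm_holder_propagatorK_reg_decay_of_cubes d L hL ha hmsq N C ε₀ creg β hcreg hβ
  refine ⟨K₀min, fun {α} hα0 hα1 => ?_⟩
  obtain ⟨c₀, hc₀, e₁, δA, hcδ, h'⟩ := h hα0 hα1
  exact ⟨c₀, hc₀, e₁, δA, hcδ,
    fun K₀ hK₀ P hPd hPL hK₀M h3M K hK1 hK hε A ec hec hle hreg g M D hg hD0 μ x x' hne l hch hend hlen hDx hDx' =>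
    h' K₀ hK₀ P hPd hPL hK₀M hK1 hK (three_half_le_sites hK h3M) hε A hec hle hreg g M D hg hD0 μ x x' hne l hch hend hlen hDx hDx'⟩

end Main

end Literature.MathematicalPhysics.QuantumFieldTheory.Balaban1983to89.B1Ineq224RegularTorus
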